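import Literature.NumberTheory.Rogawski1990.TamagawaSingularMembersFinTFOfCovol        -- ★ (W9) J2 `tamagawaSingularMembersFinTF_of_finTFCovol` (F0P3-p02 (g13)) (+ ★ p844690 Covol, ★ p844223 FinTF)
import Literature.NumberTheory.Rogawski1990.TamagawaSingularMembersOfFinTF             -- ★ p844326 (W8) `tamagawaSingularMembersExist_of_finTF_of_U`
import Literature.NumberTheory.Rogawski1990.TamagawaSingularMembersNormalisedLetter     -- ★ p844968 (F-A) `TamagawaSingularMembersExistNormalisedClosed`
import HarnessLib

/-!
# ROAD F′ (F-A): `TamagawaSingularMembersExistNormalisedClosed` from (U) + S1′-fin-TF-COVOL (Rogawski 1990 §14.5 Lemma 14.5.2 (b); §1.7; [Kt₆] Prop. 2)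

Topic `NumberTheory/Rogawski1990`; namespace `Literature.NumberTheory.Rogawski1990`.  THEOREMS ONLY (no `def`, no instance, no notation, no axiom, no named fact, no `sorry`).  Cell
`pub/hodgecm-mathlib`, ENGINE T1 (crux H413 = `stmt-HodgeConjecture-24833`); ROAD F′ «S1finTF ⟸ COVOL» (owner F0P3a-p07 (g10); LEAD F0P3a-plan (g10) T9-40 (d3), T9-45 (3) pick (F-A):
frame-restricted NORMALISED letters).  Count-neutral; HONEST LABEL: HC_CM is proved only modulo the printed citations until rung 0 closes — this file DERIVES the normalised S1′
letter from the print-verbatim covolume letter and one frame hypothesis; it discharges nothing printed.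

WHAT.  The closed head of ROAD F′: `(∀ L, (U) at L) → TamagawaSingularMembersFinTFCovolClosed → TamagawaSingularMembersExistNormalisedClosed`.  At a level-normalised S1′ frame
(`hK : νG_v(U(H′)(𝒪_v)) = 1`, MAIN-b's `IsProductHaar` conjunct — the one extra antecedent of ★ `TamagawaSingularMembersExistNormalisedClosed` over ★ `TamagawaSingularMembersExistClosed`)
the covolume letter ★ `TamagawaSingularMembersFinTFCovol` (p844690: (Q-fin)(COH-fin)(C1)-fin(NORM)(T′)+κ-block-TF, print's bare covolume identity [Rogawski1990, p. 238 l. 1, p. 239 l. 9;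
Kottwitz1988, Prop. 2]) gives S1′-fin-TF by ★ (W9) `tamagawaSingularMembersFinTF_of_finTFCovol` (F0P3-p02 (g13): the O10-s tower of partners + the `κ⁻¹`-rescaled partner family), and
S1′-fin-TF + (U) give `TamagawaSingularMembersExist` by ★ (W8) `tamagawaSingularMembersExist_of_finTF_of_U` (p844326).  (U) is ★ (W4f)'s binder `hU` closed over the carrier — an
explicit HYPOTHESIS, not a named fact (review p844247; LEAD T9-37 (3): (U)-family statements are route-side).

* **`tamagawaSingularMembersExistNormalisedClosed_of_finTFCovol_of_U`** — the closer's re-typed `stub_S1 : TamagawaSingularMembersExistNormalisedClosed := … stub_U stub_S1finTFCovol`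
  (desk fold «S1finTF ⟸ COVOL»: `stub_S1finTFCovol : TamagawaSingularMembersFinTFCovolClosed` IN, `stub_S1finTF` OUT; junction ↦ ★ `F0P3Rung0OfLettersNormalised.rung0Data_of_letters_normalised` (p845000)).

## References
* [Rogawski1990] J. D. Rogawski, *Automorphic Representations of Unitary Groups in Three Variables*, Ann. of Math. Stud. 123 (1990), §1.7 p. 6, p. 11; §4.3 pp. 43–44; §8.2
  Prop. 8.2.1 pp. 117–124; §14.2 (14.2.1) p. 232; §14.5 Lemma 14.5.2 (b) pp. 238–239.
* [Kottwitz1988] R. E. Kottwitz, *Tamagawa numbers*, Ann. of Math. 127 (1988), Thm. 1, Prop. 2.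
-/

set_option autoImplicit false

noncomputable section

open MeasureTheory Measure Filter Topology NumberField NumberField.InfinitePlace NumberField.mixedEmbedding Equiv Function Set IsDedekindDomain
open Literature.MeasureTheory.Group Literature.NumberTheory.Automorphic
open Literature.NumberTheory.Automorphic.UnitaryGroup hiding hermForm
open Literature.AlgebraicGeometry.ShimuraVarieties (unitaryGroup hermForm)
open Literature.LinearAlgebra.Matrix
open Literature.NumberTheory.Weil1964 Literature.NumberTheory.Weil1964.UnitaryArchTopForm
open scoped Classical Matrix MatrixGroups Matrix.Norms.Operator ContDiff NNReal ENNReal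

namespace Literature.NumberTheory.Rogawski1990

/-- **ROAD F′ (F-A) — THE CLOSED HEAD «S1-NORMALISED ⟸ COVOL + U».**  `(∀ L, (U) at L) → TamagawaSingularMembersFinTFCovolClosed → TamagawaSingularMembersExistNormalisedClosed`:
at every level-normalised S1′ frame, ★ (W9) `tamagawaSingularMembersFinTF_of_finTFCovol` turns the covolume letter into S1′-fin-TF and ★ (W8) `tamagawaSingularMembersExist_of_finTF_of_U`
assembles `TamagawaSingularMembersExist` from S1′-fin-TF and (U).  `hU` = ★ (W8)'s closed (U) binder VERBATIM (a HYPOTHESIS: the universal pin ratio of Prop. 8.2.1's singular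
germ, [Rogawski1990, §8.2 p. 118]).  The closer's `stub_S1` (re-typed under ROAD F′) is this theorem applied to `stub_U` and `stub_S1finTFCovol`.
[cite: Rogawski1990, §14.5 Lemma 14.5.2 (b) pp. 238–239; §8.2 Prop. 8.2.1 pp. 117–124; §1.7 p. 6, p. 11; §4.3 pp. 43–44] [cite: Kottwitz1988, Thm. 1, Prop. 2] -/
theorem tamagawaSingularMembersExistNormalisedClosed_of_finTFCovol_of_U
    (hU : ∀ (L : Type) [Field L] [NumberField L] [IsCMField L],
      ∀ [MeasurableSpace (GL (Fin 3) ℂ)] [BorelSpace (GL (Fin 3) ℂ)]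
      (α' : Fin 3 → L) (_hα' : ∀ i, α' i ≠ 0) (_hhermα : ∀ i, (IsCMField.complexConj L (α' i) : L) = α' i)
      [MeasurableSpace (arch (↥(maximalRealSubfield L)) L (IsCMField.complexConj L) 3 (Matrix.diagonal α'))] [BorelSpace (arch (↥(maximalRealSubfield L)) L (IsCMField.complexConj L) 3 (Matrix.diagonal α'))]
      (z₁ : {w : InfinitePlace L // IsComplex w} → Fin 3 → Circle) (h02 : ∀ w, z₁ w 0 = z₁ w 2) (h01 : ∀ w, z₁ w 0 ≠ z₁ w 1)
      [∀ (w : {w : InfinitePlace L // IsComplex w}) (τ : Perm (Fin 3)), MeasurableSpace (archLocal L 3 (Matrix.diagonal (α' ∘ ⇑τ)) w ⧸ Subgroup.centralizer ({(⟨circleDiagonal 3 (z₁ w), circleDiagonal_mem_archLocal_diagonal L 3 (α' ∘ ⇑τ) w (z₁ w)⟩ : archLocal L 3 (Matrix.diagonal (α' ∘ ⇑τ)) w)} : Set (archLocal L 3 (Matrix.diagonal (α' ∘ ⇑τ)) w)))]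
      [∀ (w : {w : InfinitePlace L // IsComplex w}) (τ : Perm (Fin 3)), BorelSpace (archLocal L 3 (Matrix.diagonal (α' ∘ ⇑τ)) w ⧸ Subgroup.centralizer ({(⟨circleDiagonal 3 (z₁ w), circleDiagonal_mem_archLocal_diagonal L 3 (α' ∘ ⇑τ) w (z₁ w)⟩ : archLocal L 3 (Matrix.diagonal (α' ∘ ⇑τ)) w)} : Set (archLocal L 3 (Matrix.diagonal (α' ∘ ⇑τ)) w)))],
      ∃ K : ℝ≥0, K ≠ 0 ∧
      ∀ (νH : ∀ (w : {w : InfinitePlace L // IsComplex w}) (τ : Perm (Fin 3)), Measure (Subgroup.centralizer ({(⟨circleDiagonal 3 (z₁ w), circleDiagonal_mem_archLocal_diagonal L 3 (α' ∘ ⇑τ) w (z₁ w)⟩ : archLocal L 3 (Matrix.diagonal (α' ∘ ⇑τ)) w)} : Set (archLocal L 3 (Matrix.diagonal (α' ∘ ⇑τ)) w))))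
      (hνH : ∀ w τ, (νH w τ).IsHaarMeasure ∧ (νH w τ).IsInvInvariant)
      (hpin : ∀ (w : {w : InfinitePlace L // IsComplex w}) (τ : Perm (Fin 3)), (w.1.embedding (α' (τ 0))).re * (w.1.embedding (α' (τ 2))).re < 0 →
      haveI : LocallyCompactSpace (archLocal L 3 (Matrix.diagonal (α' ∘ ⇑τ)) w) := locallyCompactSpace_archLocal L 3 (Matrix.diagonal (α' ∘ ⇑τ)) w
      haveI : SecondCountableTopology (archLocal L 3 (Matrix.diagonal (α' ∘ ⇑τ)) w) := secondCountableTopology_archLocal L 3 (Matrix.diagonal (α' ∘ ⇑τ)) w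
      haveI : (νH w τ).IsHaarMeasure := (hνH w τ).1
      haveI : (νH w τ).IsInvInvariant := (hνH w τ).2
      ∃ (ν : Measure (archLocal L 3 (Matrix.diagonal (α' ∘ ⇑τ)) w)) (_ : ν.IsHaarMeasure) (_ : ν.IsMulRightInvariant),
      ∀ (Θ : Matrix (Fin 3) (Fin 3) ℂ → ℂ), ContDiff ℝ (⊤ : ℕ∞) Θ →
      HasCompactSupport (fun k : archLocal L 3 (Matrix.diagonal (α' ∘ ⇑τ)) w => Θ ((k : GL (Fin 3) ℂ) : Matrix (Fin 3) (Fin 3) ℂ)) →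
      ∀ (z₀ : Fin 3 → Circle) (h02' : z₀ 0 = z₀ 2) (h01' : z₀ 0 ≠ z₀ 1),
      Tendsto (fun ψ : ℝ => deriv (fun ψ : ℝ => (2 * Real.sin ψ : ℂ) *
      ∫ g, Θ (((g * ⟨circleDiagonal 3 (fun i => z₀ i * Circle.exp (![(1 : ℝ), 0, -1] i * ψ)),
      circleDiagonal_mem_archLocal_diagonal L 3 (α' ∘ ⇑τ) w _⟩ * g⁻¹ : archLocal L 3 (Matrix.diagonal (α' ∘ ⇑τ)) w) : GL (Fin 3) ℂ) : Matrix (Fin 3) (Fin 3) ℂ) ∂(ν)) ψ)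
      (𝓝[≠] 0)
      (𝓝 ((-1 : ℂ) * ∫ y, descConj (⟨circleDiagonal 3 z₀, circleDiagonal_mem_archLocal_diagonal L 3 (α' ∘ ⇑τ) w z₀⟩ : archLocal L 3 (Matrix.diagonal (α' ∘ ⇑τ)) w)
      (Subgroup.centralizer ({(⟨circleDiagonal 3 (z₁ w), circleDiagonal_mem_archLocal_diagonal L 3 (α' ∘ ⇑τ) w (z₁ w)⟩ : archLocal L 3 (Matrix.diagonal (α' ∘ ⇑τ)) w)} : Set (archLocal L 3 (Matrix.diagonal (α' ∘ ⇑τ)) w)))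
      (forall_mem_centralizer_circleDiagonal_comm_of_wall L (α' ∘ ⇑τ) w (h02 w) (h01 w) h02' h01')
      (fun k : archLocal L 3 (Matrix.diagonal (α' ∘ ⇑τ)) w => Θ ((k : GL (Fin 3) ℂ) : Matrix (Fin 3) (Fin 3) ℂ)) y
      ∂(quotientMeasure _ (νH w τ) (isClosed_coe_centralizer_singleton _) (ν)))))
      (z : {w : InfinitePlace L // IsComplex w} → Fin 3 → Circle) (hwall : ∀ w, z w 0 = z w 2 ∧ z w 0 ≠ z w 1)
      (_hrat : ∃ a b : L, ∀ w : {w : InfinitePlace L // IsComplex w}, ((z w 0 : ℂ) = w.1.embedding a) ∧ ((z w 1 : ℂ) = w.1.embedding b))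
      (ρ : {w : InfinitePlace L // IsComplex w} → Perm (Fin 3))
      (ρZ : ∀ (w : {w : InfinitePlace L // IsComplex w}) (σ : Perm (Fin 3)), Measure (Subgroup.centralizer ({(⟨circleDiagonal 3 (z w ∘ ⇑σ), circleDiagonal_mem_archLocal_diagonal L 3 α' w (z w ∘ ⇑σ)⟩ : archLocal L 3 (Matrix.diagonal α') w)} : Set (archLocal L 3 (Matrix.diagonal α') w))))
      (_hρZi : ∀ w σ, (ρZ w σ).IsHaarMeasure ∧ (ρZ w σ).IsInvInvariant)
      (_hρZ : ∀ (w : {w : InfinitePlace L // IsComplex w}) (σ : Perm (Fin 3)), ¬ 0 < (w.1.embedding (α' (σ⁻¹ 0))).re * (w.1.embedding (α' (σ⁻¹ 2))).re →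
      ρZ w σ = (νH w σ⁻¹).map (subgroupCongrHomeomorph (ContinuousMulEquiv.restrictSubgroup (GLn.conjEquiv (Matrix.GeneralLinearGroup.mkOfDetNeZero _ (det_monomial_one_ne_zero 3 σ⁻¹))) (archLocal L 3 (Matrix.diagonal (α' ∘ ⇑σ⁻¹)) w) (archLocal L 3 (Matrix.diagonal α') w) (mem_archLocal_comp_perm_iff_conj_mem L 3 α' w σ⁻¹)).toMulEquiv
      (Subgroup.centralizer ({(⟨circleDiagonal 3 (z₁ w), circleDiagonal_mem_archLocal_diagonal L 3 (α' ∘ ⇑σ⁻¹) w (z₁ w)⟩ : archLocal L 3 (Matrix.diagonal (α' ∘ ⇑σ⁻¹)) w)} : Set (archLocal L 3 (Matrix.diagonal (α' ∘ ⇑σ⁻¹)) w)))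
      (Subgroup.centralizer ({(⟨circleDiagonal 3 (z w ∘ ⇑σ), circleDiagonal_mem_archLocal_diagonal L 3 α' w (z w ∘ ⇑σ)⟩ : archLocal L 3 (Matrix.diagonal α') w)} : Set (archLocal L 3 (Matrix.diagonal α') w)))
      (relabel_inv_mem_centralizer_circleDiagonal_comp_iff L α' w σ (h02 w) (h01 w) (hwall w).1 (hwall w).2)
      (ContinuousMulEquiv.restrictSubgroup (GLn.conjEquiv (Matrix.GeneralLinearGroup.mkOfDetNeZero _ (det_monomial_one_ne_zero 3 σ⁻¹))) (archLocal L 3 (Matrix.diagonal (α' ∘ ⇑σ⁻¹)) w) (archLocal L 3 (Matrix.diagonal α') w) (mem_archLocal_comp_perm_iff_conj_mem L 3 α' w σ⁻¹)).continuous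
      (ContinuousMulEquiv.restrictSubgroup (GLn.conjEquiv (Matrix.GeneralLinearGroup.mkOfDetNeZero _ (det_monomial_one_ne_zero 3 σ⁻¹))) (archLocal L 3 (Matrix.diagonal (α' ∘ ⇑σ⁻¹)) w) (archLocal L 3 (Matrix.diagonal α') w) (mem_archLocal_comp_perm_iff_conj_mem L 3 α' w σ⁻¹)).symm.continuous))
      (_hρZ1 : ∀ (w : {w : InfinitePlace L // IsComplex w}) (σ : Perm (Fin 3)), 0 < (w.1.embedding (α' (σ⁻¹ 0))).re * (w.1.embedding (α' (σ⁻¹ 2))).re → ρZ w σ Set.univ = 1)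
      (ρP : Measure (Subgroup.pi Set.univ (fun w : {w : InfinitePlace L // IsComplex w} => Subgroup.centralizer ({(⟨circleDiagonal 3 (z w ∘ ⇑(ρ w)), circleDiagonal_mem_archLocal_diagonal L 3 α' w (z w ∘ ⇑(ρ w))⟩ : archLocal L 3 (Matrix.diagonal α') w)} : Set (archLocal L 3 (Matrix.diagonal α') w)))))
      (_hρP : Measure.map (subgroupPiCoords fun w : {w : InfinitePlace L // IsComplex w} => Subgroup.centralizer ({(⟨circleDiagonal 3 (z w ∘ ⇑(ρ w)), circleDiagonal_mem_archLocal_diagonal L 3 α' w (z w ∘ ⇑(ρ w))⟩ : archLocal L 3 (Matrix.diagonal α') w)} : Set (archLocal L 3 (Matrix.diagonal α') w))) ρP = Measure.pi fun w => ρZ w (ρ w))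
      (ρ' : Measure (Subgroup.centralizer ({archDiagTorus L 3 α' (fun w => z w ∘ ⇑(ρ w))} : Set (arch (↥(maximalRealSubfield L)) L (IsCMField.complexConj L) 3 (Matrix.diagonal α')))))
      (_hρ' : ρ' = ρP.map (subgroupCongrHomeomorph (archPiEquivCM 3 L (Matrix.diagonal α')).symm.toMulEquiv (Subgroup.pi Set.univ (fun w : {w : InfinitePlace L // IsComplex w} => Subgroup.centralizer ({(⟨circleDiagonal 3 (z w ∘ ⇑(ρ w)), circleDiagonal_mem_archLocal_diagonal L 3 α' w (z w ∘ ⇑(ρ w))⟩ : archLocal L 3 (Matrix.diagonal α') w)} : Set (archLocal L 3 (Matrix.diagonal α') w)))) (Subgroup.centralizer ({archDiagTorus L 3 α' (fun w => z w ∘ ⇑(ρ w))} : Set (arch (↥(maximalRealSubfield L)) L (IsCMField.complexConj L) 3 (Matrix.diagonal α')))) (apply_mem_centralizer_iff_mem_pi_centralizer _ (archPiEquivCM 3 L (Matrix.diagonal α')).symm.toMulEquiv (archPiEquivCM_symm_circleDiagonal_eq_archDiagTorus L 3 α' (fun w => z w ∘ ⇑(ρ w)))) (archPiEquivCM 3 L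 (Matrix.diagonal α')).symm.continuous (archPiEquivCM 3 L (Matrix.diagonal α')).continuous)),
      centralizerTopFormHaar L (Matrix.diagonal α') (archDiagTorus L 3 α' (fun w => z w ∘ ⇑(ρ w))) = K • ρ')
    (hcov : TamagawaSingularMembersFinTFCovolClosed) : TamagawaSingularMembersExistNormalisedClosed := by
  intro L _ _ _ H' Tinf
  intros
  rename_i hK
  exact tamagawaSingularMembersExist_of_finTF_of_U L H' Tinf _ _ _ _ _ _ (hU L)
    (tamagawaSingularMembersFinTF_of_finTFCovol L H' Tinf _ _ _ _ _ _ hK (hcov L H' Tinf _ _ _ _ _))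

end Literature.NumberTheory.Rogawski1990

end
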